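import Summits.HodgeConjecture.CorCM.HypLiu418.OffPlaceFace
import Summits.HodgeConjecture.CorCM.HypLiu418.OffPlaceTowerHecke
import Summits.HodgeConjecture.CorCM.HypLiu418.OffPlaceCarriers
import Summits.HodgeConjecture.CorCM.HypLiu418.A3Liu418PinBettiPinningAtPin
import Summits.HodgeConjecture.HodgeConjecture.Theses.HCCMUnconditional
import Literature.NumberTheory.Automorphic.Liu2021.AppendixC.BettiPinningTransport
import HarnessLib

/-!
# a3-liu418 stub P OFF PLACE: the pinned Betti theta model at the faces whose `ι₁` is not the chosen embedding of its place

Cell `hodgecm-mathlib`, fan A — crux `hLiu418` (`stmt-HodgeConjecture-24832`), registered residual **`stub_bettiThetaModel_offPlace :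
H413 → canonicalModel_unique_printed → albanese_bettiOne_pullback_bijective → StubBettiThetaModelOffPlace`** of
`Cruxes/HLiu418/Lines/a3_liu418.lean` v4 (def :381), END plan v1 piece **D4** = the closing theorem (lead A-p02; FILE A A-p08 p605776, FILE B
A-p02 p605947, FILE C A-p12 p606168, D1 A-p02 p606534, D2 A-p17 p606431).

PROOF (Liu's `Sh(V)` does not see which of the two conjugate embeddings names the place; the tree's pin does, so off place one compares
models).  At an off-place face `(ι₁, V, a, Φ)` (`hoff : (mk ι₁).embedding ≠ ι₁`, `hΦ : ι₁ ∈ Φ`) FLIP to the face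
`(τ̄ := conj ∘ ι₁, V.alongConj, a, Φ̄)`: it is AT PLACE (✔ `OffPlaceFace.embedding_mk_starRingEnd_comp_of_ne`) and `τ̄ ∈ Φ̄`
(✔ `OffPlaceFace.starRingEnd_comp_mem_bar`), so the at-place junction ✔ `bettiThetaModelAtPlace_of_hyp413_of_pinning h413 (pinBettiPinning_of_lemma24 hL)`
gives `τ'`, a tower module `(H, rhoB)` Betti-pinned to the flipped face's §4.2 datum `ℭ₀` and theta-decomposed over its uniform Weil family `𝕌₀`.
The SAME `(τ', H, rhoB)` serves the original face: (i) the Weil side is the same term up to the index type (✔ FILE C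
`bettiThetaDecomposition_of_sameGram`, every structure map an identity); (ii) the Betti pinning is transported along the isomorphisms of the
Albanese towers `Alb X_K ≅ Alb X₀_K` commuting with `Alb(T_g)` (✔ D1 `exists_albIso_albTr_comm`, from the canonical-model uniqueness row I-4
`hU` through FILE A's tower isomorphism) by ✔ D2 `Sec42Data.BettiPinning.nonempty_transport`, after moving each face's total carrier
`sec42DataOf` (a `dite` on `4 ≤ [F:ℚ]`) to its explicit `sec42DataOfFourLe` (✔ `sec42DataOf_eq_of_four_le`, ✔ `sec42DataOf_heckeTranslates_heq`;
§1 `bettiPinning_transport_eq`).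

KERNEL: theorems only; hypotheses = the three antecedents of the registered stub (`h413` the route decl `HCCMUnconditional.H413`, `hU` row I-4,
`hL` row III-0); no `sorry`.  Nothing of [Liu2021] is asserted; HC_CM is NOT proved here; HC_CM is proved only modulo the 7 printed
citations until rung 0 closes.

References: [Liu2021] Prop. 4.13 (FJcycle.tex l. 2110–2131), §4.2 l. 2053–2081, Lem. 2.4; [Milne2005ShimuraVarieties] Thm. 13.6, Thm. 13.7 (a);
[Deligne1971TravauxShimura] 5.5.
-/

set_option autoImplicit false

noncomputable section

namespace Summit.HodgeConjecture.CorCM.Lines.A3Liu418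

open scoped TensorProduct Matrix
open CategoryTheory NumberField NumberField.InfinitePlace
open HodgeCM.Model HodgeCM.Model.LiuIndex HodgeCM.Model.TowerCarrier
open Summit.HodgeConjecture.CorCM.Model
open Summit.HodgeConjecture.CorCM.Model.RecordSystemConj (exists_albIso_albTr_comm)
open Literature.AlgebraicGeometry.Motives (CMType)
open Literature.AlgebraicGeometry.HodgeTheory Literature.NumberTheory.Automorphic.PicardCM
open Literature.AlgebraicGeometry.ShimuraVarieties.UnitaryCanonicalModel
open Literature.NumberTheory.ComplexMultiplication
open Literature.NumberTheory.Automorphic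
open Literature.NumberTheory.Automorphic.IdeleClassGroup (toHeckeCharacter isUnitary_toHeckeCharacter galConj)
open Literature.NumberTheory.Automorphic.Liu2021 Literature.NumberTheory.Automorphic.Liu2021.AppendixC
open Literature.NumberTheory.Automorphic.Liu2021.AppendixC.RestOne
open Literature.NumberTheory.Automorphic.Liu2021.Def411WeilCarriers (lineOf locF Rep)
open Summit.HodgeConjecture.CorCM.Transposition.OmegaTransport (realUnit)
open HodgeCM.Model.ArchSideTerm (e₁)
open Literature.NumberTheory.GelbartRogawski1991 Literature.NumberTheory.GelbartRogawski1991.UnitaryDualPair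
open Literature.RepresentationTheory Literature.RepresentationTheory.Liu2021
open Summit.HodgeConjecture.CorCM.Transposition
open Summit.HodgeConjecture.CorCM.D2Bridge.AdapterMuConj (muConj)
open scoped DirectSum

/-! ## §1 Moving a Betti pinning along an equality of §4.2 data (the `dite` `sec42DataOf` vs the explicit `sec42DataOfFourLe`) -/

section Transport

variable {F₀ E : Type} [Field F₀] [NumberField F₀] [IsTotallyReal F₀] [Field E] [NumberField E] [Algebra F₀ E]
  [IsTotallyComplex E] [Algebra.IsQuadraticExtension F₀ E] {P5 : PropC5Data F₀ E} {iso : ℕ → Prop}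

/-- A Betti pinning of `(H, rhoB)` to a §4.2 datum `C'` with translates `T'` is one to an EQUAL datum `C = C'` with the corresponding
translates (`HEq T T'`) — used with ✔ `sec42DataOf_eq_of_four_le` ∕ ✔ `sec42DataOf_heckeTranslates_heq` to pass between the END's total
carrier and its explicit form. [cite: Liu2021, §4.2 l. 2053–2081] -/
theorem bettiPinning_transport_eq {C C' : Sec42Data P5 iso} (e : C = C') {T : C.HeckeTranslates} {T' : C'.HeckeTranslates}
    (hT : HEq T T') {τ' : E →+* ℂ} {H : Type} [AddCommGroup H] [Module ℂ H] {rhoB : Representation ℂ P5.G H}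
    (B : Nonempty (C'.BettiPinning T' τ' H rhoB)) : Nonempty (C.BettiPinning T τ' H rhoB) := by
  subst e
  cases hT
  exact B

end Transport

/-! ## §2 Stub P off place -/

set_option synthInstance.maxHeartbeats 400000 in
set_option maxHeartbeats 8000000 in
-- (the END's carrier terms are large; the identifications below are all by definitional unfolding)
/-- **`stub_bettiThetaModel_offPlace` CLOSED from its three antecedents** — the body of `StubBettiThetaModelOffPlace` (a3-liu418 v4 def :381,
`CV`/`TV`/`UV` expanded verbatim): at every face with `hoff : (mk ι₁).embedding ≠ ι₁` and `hΦ : ι₁ ∈ Φ` there are `τ'`, a tower module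
`(H, rhoB)` Betti-pinned to `V`'s own §4.2 datum along its Hecke translates, and its [Prop 4.13] decomposition over `muConj 𝕌_V` at `a` — namely
the at-place data of the FLIPPED face `(conj ∘ ι₁, V.alongConj, a, Φ̄)`, with the Betti pinning transported along the isomorphism of the two
chosen model towers (rows I-4, III-0) and the Weil side re-indexed.  Hypotheses: `h413` (the route decl `H413` = [Prop 4.13] as printed at the pin),
`hU` (row I-4 `canonicalModel_unique_printed`, [Deligne1971TravauxShimura] 5.5 ∕ [Milne2005ShimuraVarieties] Thm. 13.7 (a)), `hL` (row III-0
`albanese_bettiOne_pullback_bijective`, [Liu2021] Lem. 2.4). [cite: Liu2021, Prop. 4.13 (FJcycle.tex l. 2110–2131); §4.2 l. 2074–2081; Lem. 2.4]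
[cite: Milne2005ShimuraVarieties, Thm. 13.7 (a) p. 119] -/
theorem stubBettiThetaModelOffPlace_of_h413_of_unique_of_lemma24
    (h413 : Summit.HodgeConjecture.HodgeConjecture.Theses.HCCMUnconditional.H413)
    (hU : canonicalModel_unique_printed) (hL : albanese_bettiOne_pullback_bijective) :
    ∀ (hDel : Literature.AlgebraicGeometry.ShimuraVarieties.UnitaryCanonicalModel.canonicalModel_exists_printed)
      (F : HodgeCM.CMField) [IsGalois ℚ F] (h6 : 6 ≤ Module.finrank ℚ F) {ι₁ : F →+* ℂ} (V : HodgeCM.HermSpace3 F ι₁)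
      (hoff : (NumberField.InfinitePlace.mk ι₁).embedding ≠ ι₁) (a : RealScalar F) (Φ : CMType F) (hΦ : ι₁ ∈ Φ.1),
      ∃ (τ' : (F : Type) →+* ℂ) (H : Type) (_ : AddCommGroup H) (_ : Module ℂ H) (rhoB : Representation ℂ (sec42DataOf (Summit.HodgeConjecture.CorCM.DelRec.exists_recordSystem_of_printed hDel) isoOf ⟨HodgeCM.CMField.K F⟩ ι₁ ⟨HodgeCM.HermSpace3.Hm V, HodgeCM.HermSpace3.isHermitian V, HodgeCM.HermSpace3.signature_ι₁ V, HodgeCM.HermSpace3.posDef_of_ne V⟩ Φ).G H),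
        Nonempty ((sec42DataOf (Summit.HodgeConjecture.CorCM.DelRec.exists_recordSystem_of_printed hDel) isoOf ⟨HodgeCM.CMField.K F⟩ ι₁ ⟨HodgeCM.HermSpace3.Hm V, HodgeCM.HermSpace3.isHermitian V, HodgeCM.HermSpace3.signature_ι₁ V, HodgeCM.HermSpace3.posDef_of_ne V⟩ Φ).BettiPinning (heckeTranslatesFamilyOf heckeTranslate_definedOver_holds (Summit.HodgeConjecture.CorCM.DelRec.exists_recordSystem_of_printed hDel) isoOf ⟨HodgeCM.CMField.K F⟩ ι₁ ⟨HodgeCM.HermSpace3.Hm V, HodgeCM.HermSpace3.isHermitian V, HodgeCM.HermSpace3.signature_ι₁ V, HodgeCM.HermSpace3.posDef_of_ne V⟩ Φ h6) τ' H rhoB) ∧ BettiThetaDecomposition (Summit.HodgeConjecture.CorCM.D2Bridge.AdapterMuConj.muConj (uniformOmegaRep (Summit.HodgeConjecture.CorCM.DelRec.exists_recordSystem_of_printed hDel) ⟨HodgeCM.CMField.K F⟩ ι₁ ⟨HodgeCM.HermSpace3.Hm V, HodgeCM.HermSpace3.isHermitian V, HodgeCM.HermSpace3.signature_ι₁ V,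 HodgeCM.HermSpace3.posDef_of_ne V⟩ Φ e₁ (frameD V) (frameD_real V) (frameD_ne V) (ιVE V) (2 * imagUnit (HodgeCM.CMField.K F))⁻¹ (fun _ _ => (Rep.update ↥(maximalRealSubfield (HodgeCM.CMField.K F)) (imagUnitSq (HodgeCM.CMField.K F)) (Rep.ofLineOf ↥(maximalRealSubfield (HodgeCM.CMField.K F)) (imagUnitSq (HodgeCM.CMField.K F))) (locF ↥(maximalRealSubfield (HodgeCM.CMField.K F)) (imagUnitSq (HodgeCM.CMField.K F)) (realUnit ⟨HodgeCM.CMField.K F⟩ a.1 a.2.1 a.2.2)) (realUnit ⟨HodgeCM.CMField.K F⟩ a.1 a.2.1 a.2.2) rfl)))) H rhoB := by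
  intro hDel F _ h6 ι₁ V hoff a Φ hΦ
  -- the flipped face `(τ̄, V.alongConj, a, Φ̄)` is at place and carries `τ̄ ∈ Φ̄`
  have hemb := Summit.HodgeConjecture.CorCM.OffPlaceFace.embedding_mk_starRingEnd_comp_of_ne hoff
  have hΦ' : (starRingEnd ℂ).comp ι₁ ∈ (CMTypeOps.bar Φ).1 := Summit.HodgeConjecture.CorCM.OffPlaceFace.starRingEnd_comp_mem_bar hΦ
  obtain ⟨τ', H, _, _, rhoB, ⟨B₀⟩, hΘ₀⟩ :=
    bettiThetaModelAtPlace_of_hyp413_of_pinning h413 (pinBettiPinning_of_lemma24 hL) hDel F h6 V.alongConj hemb a (CMTypeOps.bar Φ) hΦ'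
  refine ⟨τ', H, inferInstance, inferInstance, rhoB, ?_, ?_⟩
  · -- (ii) the Betti pinning: dite ↦ explicit at the flipped face, transport along the Albanese isomorphisms (D1 + D2), explicit ↦ dite back
    have h4 : 4 ≤ Module.finrank ℚ F := le_trans (by norm_num) h6
    obtain ⟨B₀'⟩ := bettiPinning_transport_eq
      (sec42DataOf_eq_of_four_le (Summit.HodgeConjecture.CorCM.DelRec.exists_recordSystem_of_printed hDel)
        (⟨HodgeCM.HermSpace3.Hm V.alongConj, HodgeCM.HermSpace3.isHermitian V.alongConj, HodgeCM.HermSpace3.signature_ι₁ V.alongConj,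
          HodgeCM.HermSpace3.posDef_of_ne V.alongConj⟩ : HermSpace3 ⟨HodgeCM.CMField.K F⟩ ((starRingEnd ℂ).comp ι₁)) (CMTypeOps.bar Φ) isoOf h4).symm
      (sec42DataOf_heckeTranslates_heq heckeTranslate_definedOver_holds (Summit.HodgeConjecture.CorCM.DelRec.exists_recordSystem_of_printed hDel)
        (⟨HodgeCM.HermSpace3.Hm V.alongConj, HodgeCM.HermSpace3.isHermitian V.alongConj, HodgeCM.HermSpace3.signature_ι₁ V.alongConj,
          HodgeCM.HermSpace3.posDef_of_ne V.alongConj⟩ : HermSpace3 ⟨HodgeCM.CMField.K F⟩ ((starRingEnd ℂ).comp ι₁)) (CMTypeOps.bar Φ) isoOf h4).symm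
      ⟨B₀⟩
    obtain ⟨α, hα⟩ := exists_albIso_albTr_comm heckeTranslate_definedOver_holds hU
      (Summit.HodgeConjecture.CorCM.DelRec.exists_recordSystem_of_printed hDel)
      (⟨HodgeCM.HermSpace3.Hm V, HodgeCM.HermSpace3.isHermitian V, HodgeCM.HermSpace3.signature_ι₁ V, HodgeCM.HermSpace3.posDef_of_ne V⟩ :
        HermSpace3 ⟨HodgeCM.CMField.K F⟩ ι₁) Φ (CMTypeOps.bar Φ) h4
      (isoOf ⟨HodgeCM.CMField.K F⟩ ι₁ ⟨HodgeCM.HermSpace3.Hm V, HodgeCM.HermSpace3.isHermitian V, HodgeCM.HermSpace3.signature_ι₁ V,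
        HodgeCM.HermSpace3.posDef_of_ne V⟩ Φ)
      (isoOf ⟨HodgeCM.CMField.K F⟩ ((starRingEnd ℂ).comp ι₁) ⟨HodgeCM.HermSpace3.Hm V.alongConj, HodgeCM.HermSpace3.isHermitian V.alongConj,
        HodgeCM.HermSpace3.signature_ι₁ V.alongConj, HodgeCM.HermSpace3.posDef_of_ne V.alongConj⟩ (CMTypeOps.bar Φ))
    have B₁' := Sec42Data.BettiPinning.nonempty_transport
      (sec42DataOfFourLe_heckeTranslates heckeTranslate_definedOver_holds (Summit.HodgeConjecture.CorCM.DelRec.exists_recordSystem_of_printed hDel)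
        (⟨HodgeCM.HermSpace3.Hm V, HodgeCM.HermSpace3.isHermitian V, HodgeCM.HermSpace3.signature_ι₁ V, HodgeCM.HermSpace3.posDef_of_ne V⟩ :
          HermSpace3 ⟨HodgeCM.CMField.K F⟩ ι₁) Φ h4
        (isoOf ⟨HodgeCM.CMField.K F⟩ ι₁ ⟨HodgeCM.HermSpace3.Hm V, HodgeCM.HermSpace3.isHermitian V, HodgeCM.HermSpace3.signature_ι₁ V,
          HodgeCM.HermSpace3.posDef_of_ne V⟩ Φ))
      (sec42DataOfFourLe_heckeTranslates heckeTranslate_definedOver_holds (Summit.HodgeConjecture.CorCM.DelRec.exists_recordSystem_of_printed hDel)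
        (⟨HodgeCM.HermSpace3.Hm V.alongConj, HodgeCM.HermSpace3.isHermitian V.alongConj, HodgeCM.HermSpace3.signature_ι₁ V.alongConj,
          HodgeCM.HermSpace3.posDef_of_ne V.alongConj⟩ : HermSpace3 ⟨HodgeCM.CMField.K F⟩ ((starRingEnd ℂ).comp ι₁)) (CMTypeOps.bar Φ) h4
        (isoOf ⟨HodgeCM.CMField.K F⟩ ((starRingEnd ℂ).comp ι₁) ⟨HodgeCM.HermSpace3.Hm V.alongConj, HodgeCM.HermSpace3.isHermitian V.alongConj,
          HodgeCM.HermSpace3.signature_ι₁ V.alongConj, HodgeCM.HermSpace3.posDef_of_ne V.alongConj⟩ (CMTypeOps.bar Φ)))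
      (fun g => g) (fun K => K) (fun K => ⟨K, rfl⟩) (fun hK => hK) α hα (rhoB := rhoB) (rhoB' := rhoB) (fun _ => rfl) B₀'
    exact bettiPinning_transport_eq
      (sec42DataOf_eq_of_four_le (Summit.HodgeConjecture.CorCM.DelRec.exists_recordSystem_of_printed hDel)
        (⟨HodgeCM.HermSpace3.Hm V, HodgeCM.HermSpace3.isHermitian V, HodgeCM.HermSpace3.signature_ι₁ V, HodgeCM.HermSpace3.posDef_of_ne V⟩ :
          HermSpace3 ⟨HodgeCM.CMField.K F⟩ ι₁) Φ isoOf h4)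
      (sec42DataOf_heckeTranslates_heq heckeTranslate_definedOver_holds (Summit.HodgeConjecture.CorCM.DelRec.exists_recordSystem_of_printed hDel)
        (⟨HodgeCM.HermSpace3.Hm V, HodgeCM.HermSpace3.isHermitian V, HodgeCM.HermSpace3.signature_ι₁ V, HodgeCM.HermSpace3.posDef_of_ne V⟩ :
          HermSpace3 ⟨HodgeCM.CMField.K F⟩ ι₁) Φ isoOf h4) B₁'
  · -- (i) the Weil side: same carriers, re-indexed (FILE C)
    exact bettiThetaDecomposition_of_sameGram (Summit.HodgeConjecture.CorCM.DelRec.exists_recordSystem_of_printed hDel) F V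
      (HodgeCM.HermSpace3.signature_ι₁ V.alongConj) (HodgeCM.HermSpace3.posDef_of_ne V.alongConj) a Φ (CMTypeOps.bar Φ) H rhoB hΘ₀


section OffPlaceTwin

open Summit.HodgeConjecture.CorCM.Transposition

set_option synthInstance.maxHeartbeats 400000 in
set_option maxHeartbeats 8000000 in
-- (the END's carrier terms are large; the identifications below are all by definitional unfolding)
/-- **OFF-PLACE TWIN over the PINNING (row III-0 taken as the pinning itself, not as Lemma 2.4)** — the same conclusion as
`stubBettiThetaModelOffPlace_of_h413_of_unique_of_lemma24`, with the hypothesis `hL : albanese_bettiOne_pullback_bijective` (row III-0 as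
typed) replaced by EXACTLY what the proof uses of it, the Betti pinning `hpin` at every at-place face (the type returned by
`pinBettiPinning_of_lemma24`, verbatim = the `hpin` binder of `bettiThetaModelAtPlace_of_hyp413_of_pinning`); so that the off-place face closes
from ANY provenance of the pinning (the III-0 edition of `a3_liu418`: `pinBettiPinning_holds` from the Jacobian-dimension road, A-plan2 census
2026-08-28T07:30:48Z (β)).  Proof: the p607116 proof with `pinBettiPinning_of_lemma24 hL` replaced by `hpin`.
[cite: Liu2021, Prop. 4.13 (FJcycle.tex l. 2110–2131); §4.2 l. 2074–2081] [cite: Milne2005ShimuraVarieties, Thm. 13.7 (a) p. 119] -/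
theorem stubBettiThetaModelOffPlace_of_h413_of_unique_of_pinning
    (h413 : Summit.HodgeConjecture.HodgeConjecture.Theses.HCCMUnconditional.H413)
    (hU : canonicalModel_unique_printed)
    (hpin : ∀ (hDel : Literature.AlgebraicGeometry.ShimuraVarieties.UnitaryCanonicalModel.canonicalModel_exists_printed)
      (F : HodgeCM.CMField) [IsGalois ℚ F] (h6 : 6 ≤ Module.finrank ℚ F) {ι₁ : F →+* ℂ} (V : HodgeCM.HermSpace3 F ι₁) (a : RealScalar F) (Φ : CMType F),
      ∃ τ' : (F : Type) →+* ℂ, Nonempty ((sec42DataOf (Summit.HodgeConjecture.CorCM.DelRec.exists_recordSystem_of_printed hDel) isoOf ⟨HodgeCM.CMField.K F⟩ ι₁ ⟨HodgeCM.HermSpace3.Hm V, HodgeCM.HermSpace3.isHermitian V, HodgeCM.HermSpace3.signature_ι₁ V, HodgeCM.HermSpace3.posDef_of_ne V⟩ Φ).BettiPinning (heckeTranslatesFamilyOf heckeTranslate_definedOver_holds (Summit.HodgeConjecture.CorCM.DelRec.exists_recordSystem_of_printed hDel) isoOf ⟨HodgeCM.CMField.K F⟩ ι₁ ⟨HodgeCM.HermSpace3.Hm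 V, HodgeCM.HermSpace3.isHermitian V, HodgeCM.HermSpace3.signature_ι₁ V, HodgeCM.HermSpace3.posDef_of_ne V⟩ Φ h6) τ' ((liuDictionaryPin exists_isReal_hodgeModel_holds hodgePQ_independent_of_hodgeModel_holds BallQuotient.ballQuotientUniformised_holds (cmAbelianVarietyRealised_of_eigenbasis exists_isReal_hodgeModel_holds hodgePQ_independent_of_hodgeModel_holds cmAbelianVarietyEigenbasisRealised_holds) Literature.NumberTheory.Transcendental.arapura2012_cor_15_4_6_holds V (I V (repAt a) (muLiu ι₁ GramClass.rep)) (line V (repAt a) (muLiu ι₁ GramClass.rep)))).H (Representation.ofModule' _))) :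
    ∀ (hDel : Literature.AlgebraicGeometry.ShimuraVarieties.UnitaryCanonicalModel.canonicalModel_exists_printed)
      (F : HodgeCM.CMField) [IsGalois ℚ F] (h6 : 6 ≤ Module.finrank ℚ F) {ι₁ : F →+* ℂ} (V : HodgeCM.HermSpace3 F ι₁)
      (hoff : (NumberField.InfinitePlace.mk ι₁).embedding ≠ ι₁) (a : RealScalar F) (Φ : CMType F) (hΦ : ι₁ ∈ Φ.1),
      ∃ (τ' : (F : Type) →+* ℂ) (H : Type) (_ : AddCommGroup H) (_ : Module ℂ H) (rhoB : Representation ℂ (sec42DataOf (Summit.HodgeConjecture.CorCM.DelRec.exists_recordSystem_of_printed hDel) isoOf ⟨HodgeCM.CMField.K F⟩ ι₁ ⟨HodgeCM.HermSpace3.Hm V, HodgeCM.HermSpace3.isHermitian V, HodgeCM.HermSpace3.signature_ι₁ V, HodgeCM.HermSpace3.posDef_of_ne V⟩ Φ).G H),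
        Nonempty ((sec42DataOf (Summit.HodgeConjecture.CorCM.DelRec.exists_recordSystem_of_printed hDel) isoOf ⟨HodgeCM.CMField.K F⟩ ι₁ ⟨HodgeCM.HermSpace3.Hm V, HodgeCM.HermSpace3.isHermitian V, HodgeCM.HermSpace3.signature_ι₁ V, HodgeCM.HermSpace3.posDef_of_ne V⟩ Φ).BettiPinning (heckeTranslatesFamilyOf heckeTranslate_definedOver_holds (Summit.HodgeConjecture.CorCM.DelRec.exists_recordSystem_of_printed hDel) isoOf ⟨HodgeCM.CMField.K F⟩ ι₁ ⟨HodgeCM.HermSpace3.Hm V, HodgeCM.HermSpace3.isHermitian V, HodgeCM.HermSpace3.signature_ι₁ V, HodgeCM.HermSpace3.posDef_of_ne V⟩ Φ h6) τ' H rhoB) ∧ BettiThetaDecomposition (Summit.HodgeConjecture.CorCM.D2Bridge.AdapterMuConj.muConj (uniformOmegaRep (Summit.HodgeConjecture.CorCM.DelRec.exists_recordSystem_of_printed hDel) ⟨HodgeCM.CMField.K F⟩ ι₁ ⟨HodgeCM.HermSpace3.Hm V, HodgeCM.HermSpace3.isHermitian V, HodgeCM.HermSpace3.signature_ι₁ V,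 HodgeCM.HermSpace3.posDef_of_ne V⟩ Φ e₁ (frameD V) (frameD_real V) (frameD_ne V) (ιVE V) (2 * imagUnit (HodgeCM.CMField.K F))⁻¹ (fun _ _ => (Rep.update ↥(maximalRealSubfield (HodgeCM.CMField.K F)) (imagUnitSq (HodgeCM.CMField.K F)) (Rep.ofLineOf ↥(maximalRealSubfield (HodgeCM.CMField.K F)) (imagUnitSq (HodgeCM.CMField.K F))) (locF ↥(maximalRealSubfield (HodgeCM.CMField.K F)) (imagUnitSq (HodgeCM.CMField.K F)) (realUnit ⟨HodgeCM.CMField.K F⟩ a.1 a.2.1 a.2.2)) (realUnit ⟨HodgeCM.CMField.K F⟩ a.1 a.2.1 a.2.2) rfl)))) H rhoB := by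
  intro hDel F _ h6 ι₁ V hoff a Φ hΦ
  -- the flipped face `(τ̄, V.alongConj, a, Φ̄)` is at place and carries `τ̄ ∈ Φ̄`
  have hemb := Summit.HodgeConjecture.CorCM.OffPlaceFace.embedding_mk_starRingEnd_comp_of_ne hoff
  have hΦ' : (starRingEnd ℂ).comp ι₁ ∈ (CMTypeOps.bar Φ).1 := Summit.HodgeConjecture.CorCM.OffPlaceFace.starRingEnd_comp_mem_bar hΦ
  obtain ⟨τ', H, _, _, rhoB, ⟨B₀⟩, hΘ₀⟩ :=
    bettiThetaModelAtPlace_of_hyp413_of_pinning h413 hpin hDel F h6 V.alongConj hemb a (CMTypeOps.bar Φ) hΦ'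
  refine ⟨τ', H, inferInstance, inferInstance, rhoB, ?_, ?_⟩
  · -- (ii) the Betti pinning: dite ↦ explicit at the flipped face, transport along the Albanese isomorphisms (D1 + D2), explicit ↦ dite back
    have h4 : 4 ≤ Module.finrank ℚ F := le_trans (by norm_num) h6
    obtain ⟨B₀'⟩ := bettiPinning_transport_eq
      (sec42DataOf_eq_of_four_le (Summit.HodgeConjecture.CorCM.DelRec.exists_recordSystem_of_printed hDel)
        (⟨HodgeCM.HermSpace3.Hm V.alongConj, HodgeCM.HermSpace3.isHermitian V.alongConj, HodgeCM.HermSpace3.signature_ι₁ V.alongConj,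
          HodgeCM.HermSpace3.posDef_of_ne V.alongConj⟩ : HermSpace3 ⟨HodgeCM.CMField.K F⟩ ((starRingEnd ℂ).comp ι₁)) (CMTypeOps.bar Φ) isoOf h4).symm
      (sec42DataOf_heckeTranslates_heq heckeTranslate_definedOver_holds (Summit.HodgeConjecture.CorCM.DelRec.exists_recordSystem_of_printed hDel)
        (⟨HodgeCM.HermSpace3.Hm V.alongConj, HodgeCM.HermSpace3.isHermitian V.alongConj, HodgeCM.HermSpace3.signature_ι₁ V.alongConj,
          HodgeCM.HermSpace3.posDef_of_ne V.alongConj⟩ : HermSpace3 ⟨HodgeCM.CMField.K F⟩ ((starRingEnd ℂ).comp ι₁)) (CMTypeOps.bar Φ) isoOf h4).symm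
      ⟨B₀⟩
    obtain ⟨α, hα⟩ := exists_albIso_albTr_comm heckeTranslate_definedOver_holds hU
      (Summit.HodgeConjecture.CorCM.DelRec.exists_recordSystem_of_printed hDel)
      (⟨HodgeCM.HermSpace3.Hm V, HodgeCM.HermSpace3.isHermitian V, HodgeCM.HermSpace3.signature_ι₁ V, HodgeCM.HermSpace3.posDef_of_ne V⟩ :
        HermSpace3 ⟨HodgeCM.CMField.K F⟩ ι₁) Φ (CMTypeOps.bar Φ) h4
      (isoOf ⟨HodgeCM.CMField.K F⟩ ι₁ ⟨HodgeCM.HermSpace3.Hm V, HodgeCM.HermSpace3.isHermitian V, HodgeCM.HermSpace3.signature_ι₁ V,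
        HodgeCM.HermSpace3.posDef_of_ne V⟩ Φ)
      (isoOf ⟨HodgeCM.CMField.K F⟩ ((starRingEnd ℂ).comp ι₁) ⟨HodgeCM.HermSpace3.Hm V.alongConj, HodgeCM.HermSpace3.isHermitian V.alongConj,
        HodgeCM.HermSpace3.signature_ι₁ V.alongConj, HodgeCM.HermSpace3.posDef_of_ne V.alongConj⟩ (CMTypeOps.bar Φ))
    have B₁' := Sec42Data.BettiPinning.nonempty_transport
      (sec42DataOfFourLe_heckeTranslates heckeTranslate_definedOver_holds (Summit.HodgeConjecture.CorCM.DelRec.exists_recordSystem_of_printed hDel)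
        (⟨HodgeCM.HermSpace3.Hm V, HodgeCM.HermSpace3.isHermitian V, HodgeCM.HermSpace3.signature_ι₁ V, HodgeCM.HermSpace3.posDef_of_ne V⟩ :
          HermSpace3 ⟨HodgeCM.CMField.K F⟩ ι₁) Φ h4
        (isoOf ⟨HodgeCM.CMField.K F⟩ ι₁ ⟨HodgeCM.HermSpace3.Hm V, HodgeCM.HermSpace3.isHermitian V, HodgeCM.HermSpace3.signature_ι₁ V,
          HodgeCM.HermSpace3.posDef_of_ne V⟩ Φ))
      (sec42DataOfFourLe_heckeTranslates heckeTranslate_definedOver_holds (Summit.HodgeConjecture.CorCM.DelRec.exists_recordSystem_of_printed hDel)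
        (⟨HodgeCM.HermSpace3.Hm V.alongConj, HodgeCM.HermSpace3.isHermitian V.alongConj, HodgeCM.HermSpace3.signature_ι₁ V.alongConj,
          HodgeCM.HermSpace3.posDef_of_ne V.alongConj⟩ : HermSpace3 ⟨HodgeCM.CMField.K F⟩ ((starRingEnd ℂ).comp ι₁)) (CMTypeOps.bar Φ) h4
        (isoOf ⟨HodgeCM.CMField.K F⟩ ((starRingEnd ℂ).comp ι₁) ⟨HodgeCM.HermSpace3.Hm V.alongConj, HodgeCM.HermSpace3.isHermitian V.alongConj,
          HodgeCM.HermSpace3.signature_ι₁ V.alongConj, HodgeCM.HermSpace3.posDef_of_ne V.alongConj⟩ (CMTypeOps.bar Φ)))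
      (fun g => g) (fun K => K) (fun K => ⟨K, rfl⟩) (fun hK => hK) α hα (rhoB := rhoB) (rhoB' := rhoB) (fun _ => rfl) B₀'
    exact bettiPinning_transport_eq
      (sec42DataOf_eq_of_four_le (Summit.HodgeConjecture.CorCM.DelRec.exists_recordSystem_of_printed hDel)
        (⟨HodgeCM.HermSpace3.Hm V, HodgeCM.HermSpace3.isHermitian V, HodgeCM.HermSpace3.signature_ι₁ V, HodgeCM.HermSpace3.posDef_of_ne V⟩ :
          HermSpace3 ⟨HodgeCM.CMField.K F⟩ ι₁) Φ isoOf h4)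
      (sec42DataOf_heckeTranslates_heq heckeTranslate_definedOver_holds (Summit.HodgeConjecture.CorCM.DelRec.exists_recordSystem_of_printed hDel)
        (⟨HodgeCM.HermSpace3.Hm V, HodgeCM.HermSpace3.isHermitian V, HodgeCM.HermSpace3.signature_ι₁ V, HodgeCM.HermSpace3.posDef_of_ne V⟩ :
          HermSpace3 ⟨HodgeCM.CMField.K F⟩ ι₁) Φ isoOf h4) B₁'
  · -- (i) the Weil side: same carriers, re-indexed (FILE C)
    exact bettiThetaDecomposition_of_sameGram (Summit.HodgeConjecture.CorCM.DelRec.exists_recordSystem_of_printed hDel) F V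
      (HodgeCM.HermSpace3.signature_ι₁ V.alongConj) (HodgeCM.HermSpace3.posDef_of_ne V.alongConj) a Φ (CMTypeOps.bar Φ) H rhoB hΘ₀

end OffPlaceTwin

end Summit.HodgeConjecture.CorCM.Lines.A3Liu418

end
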